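import Summits.QuantumFields.YangMills.Theorems.IR.BlockedActivityWStrongCouplingKR
import Summits.QuantumFields.YangMills.Theorems.IR.BlockedActivityWRefine
import HarnessLib

/-!
# Crux `IR` (stmt-QuantumFields-19354), lane B «strong coupling AFTER BLOCKING»: **TV ⇒ W** — the class of record at mesh `K·b` from the
# universal shell condition (the crux's total-variation mixing format) at mesh `b`, at EVERY `β`

Helper module for item `stmt-QuantumFields-19354` (`--supports`; it closes nothing), lane `ym-19354-onsetsc-p2` (g6).

THE QUESTION (g3 CURRENCY-MEMO F1∕(iii), LANE-B-WEB rev 5): the lane's class of record `BlockedActivityClassW` IS centre-cell RATIO mixing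
(`blockedActivityClassW_of_centreRatio_le`), and it implies the format's total-variation mixing (`univShellCond_of_blockedActivityW_sharp`).  Does the
format's TV mixing conversely give the class — is the «RATIO upgrade» free?  ANSWER (σ-uniform currency, every `β`, every compact `G`): YES, at a
coarser mesh.  The chain:

* §1 `univShellCond_cell_decay` — the tree's Dobrushin–Shlosman bootstrap (`FiniteSizeCriterion.recursion_decay` fed by
  `AfPincerUc.Bootstrap.frameFS_of_univShellCond`) is SHAPE-BLIND: `UnivShellCond ρ β b n ε` gives, on every mesh-`b` frame, for EVERY cell union `Λ`
  (inside the window or not) and every cell `x`, influence `≤ (ε·shellCount n)^j` on `[0,1]`-observables of the cell `x` of exterior changes off `Λ`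
  beyond cell distance `j(2n+1)` from `x` (the bootstrap `univShellCond_bootstrap` of p522910 is the case `Λ ⊆` window).
* §2 `linkRatio_influence_of_univShellCond` — the single analytic input of g5's parametric chain (`blockedActivityClassW_of_influence`): on a COARSE frame
  of mesh `K·b`, `K ≥ j(2n+1)+2`, the inner-kernel averages of the one-link Boltzmann ratio `linkRatio` (`|E| ≤ e^{12N|β|}`, a cylinder on the `≤ 24` links of
  the plaquettes through the link) under two exteriors agreeing off the inner volume within sup-distance `2K·b` of the link differ by at most
  `ι = 48·e^{12N|β|}·(ε·shellCount n)^j`.  Proof: REFINE the coarse frame into a mesh-`b` frame (`refineFrame`, `Theorems/IR/BlockedActivityWRefine`: the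
  inner volume is a union of fine cells), run the chain rule `FiniteSizeCriterion.multiCell_influence_general_of_abs_le` (DLR peeling, ≤ 24 fine cells) on
  the single-cell decay of §1, and check that fine cells within index distance `j(2n+1)` of the link's plaquette neighbourhood lie within sup-distance
  `2(j(2n+1)+2)·b ≤ 2K·b` (`floor_norm_le_of_near_plaqNbhd`).
* §3 ★ `blockedActivityClassW_of_univShellCond` — **`UnivShellCond r.ρ β b n ε`, `ε ≥ 0`, `b ≥ 1`, `K ≥ j(2n+1)+2` ⇒
  `BlockedActivityClassW r.ρ β (K·b) 1 (mixingRadius r.N β (ε·shellCount n) (K·b) j)`**, `mixingRadius N β θ B j = exp(3072·B⁴·e^{24N|β|}·θ^j) − 1`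
  (g3∕g5's radius shape with the Dobrushin factor `q^{2nb}` replaced by the bootstrap factor `θ^j`); `blockedActivityTypWAll_of_univShellCond` (every `Typ`),
  `ratioClauseI_of_univShellCond` (RATIO clause (i) at the coarse frame, every `Typ`).
* §4 `pow_four_mul_geom_tendsto_zero`, `mixingRadius_linear_tendsto_zero`, ★ `blockedActivityClassW_eventually_of_univShellCond` — with `ε·shellCount n < 1`: for every radius `a > 0`, class W at
  radius `a` at ALL meshes `(j(2n+1)+2)·b`, `j ≥ j₀(β, b, a)`; `exists_mesh_blockedActivityClassW_of_univShellCond`.  The onset corollaries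
  (`BlockedActivityOnsetAtW r.ρ ↔` universal TV onset; `OnsetMixing → BlockedActivityOnsetSCW`) are in `Theorems/IR/BlockedActivityWOnsetIff`.

THE NUMBER (mesh loss of the upgrade).  The W-mesh is `B = K·b` with the least `j` such that `3072·B⁴·e^{24N|β|}·θ^j ≤ log(1+a)`: `K ≍ (2n+1)·
(24N|β| + 4·log B + log(3072∕a))∕log(1∕θ)`.  [arith] at `(n, ε) = (1, 1∕3552)` (`θ = 1∕2`), `a = a⋆ = radiusKP(1∕3552) ≈ 2.85·10⁻⁹`, `N = 2`, tree `|β| = 1`,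
`b = 1`: `j ≈ 144`, `B ≈ 434`; the term `24N|β|∕log 2 ≈ 34.6·N|β|` makes `B∕b` grow LINEARLY in `β` — so the NT-CALIBRATED onset statements (`…CalSCW`, mesh
`a(β)·b < T`) are NOT obtained from a calibrated TV onset by this route (log-in-`ξ` loss if `b(β) ≍ ξ(β) ≍ e^{cβ}`); only the uncalibrated onsets are
equivalent.  The factor `e^{24N|β|}` is the price of converting an ADDITIVE (TV) bound on the link-ratio average into a MULTIPLICATIVE one; it is intrinsic to
any TV ⇒ ratio conversion at the link level.

TYP-RELATIVISED VERSION — located obstruction (not claimed): the same peeling for `FixedMesh.ClauseI ρ β w n ε Typ` (TV for pairs typical off the region)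
would need the hole datum — the centre-cell configuration, which is EXTERIOR to the inner volume — to be typical; `RatioClauseI … Typ` quantifies over ALL
centre data.  So `RatioClauseI(Typ) ⇐ ClauseI(Typ)` does not follow by this route unless `Typ 0 = univ`; g3's F1 (RATIO clause (i) ⇒ W|Typ conjunct) remains
one-directional for genuine `Typ`.

HONEST FRAMING: implications between OPEN onset∕mixing statements of one CONDITIONAL chain, valid at every `β` for every compact `G`; nothing here asserts
mixing at any `β`, the onset at `b(β) ≍ ξ(β)`, a mass gap or Clay.  No `sorry`; axioms ⊆ {propext, Classical.choice, Quot.sound}; no instances, no notation.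
Refs: Dobrushin–Shlosman 1985 §2 (constructive criterion, block recursion); Martinelli 1999 §2.3; van den Berg–Maes 1994; Georgii 2011 §8.2.
-/

set_option autoImplicit false

noncomputable section

open MeasureTheory ProbabilityTheory Filter Topology
open Literature.MathematicalPhysics
open Literature.MathematicalPhysics.QuantumLattice
open Summit.QuantumFields.YangMills.Cruxes.IR.Tempered (cellEdges windowCells regionEdges collarEdges)
open Summit.QuantumFields.YangMills.Cruxes.IR.CellTempered.Engine (frameCell frameCell_eq_iff mem_cellEdges_frameCell frame_hC1 finite_frameCell
  regionEdges_union shiftFrame shiftFrame_mesh)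
open Summit.QuantumFields.YangMills.Cruxes.IR.OnsetFormats (shellCount UnivShellCond)
open Summit.QuantumFields.YangMills.Cruxes.IR.AfPincerUc.Bootstrap (frameFS_of_univShellCond recursionCount_eq_shellCount)
open Summit.QuantumFields.YangMills.Theorems.FiniteSizeCriterion (recursion_decay multiCell_influence_general_of_abs_le)

namespace Summit.QuantumFields.YangMills.Cruxes.IR.BlockedActivity

/-! ## §1 The shape-blind decay of the universal shell condition: any centre, any cell union -/

section Decay

variable {G : Type} [Group G] [TopologicalSpace G] [IsTopologicalGroup G] [CompactSpace G] [MeasurableSpace G] [BorelSpace G]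
  [SecondCountableTopology G] [T2Space G] {N : ℕ} (ρ : G →* Matrix (Fin N) (Fin N) ℂ)

omit [SecondCountableTopology G] [T2Space G] in
/-- `shellCount n ≥ 0`. -/
theorem shellCount_nonneg' (n : ℕ) : 0 ≤ shellCount n := by
  unfold Summit.QuantumFields.YangMills.Cruxes.IR.OnsetFormats.shellCount
  exact Nat.cast_nonneg _

/-- **The universal shell condition decays at EVERY centre of EVERY cell union** (Dobrushin–Shlosman block recursion of the tree, shape-blind):
`UnivShellCond ρ β b n ε` (`b ≥ 1`, `ε ≥ 0`, continuous `ρ`, Hausdorff second-countable `G`) ⇒ on every mesh-`b` frame `u`, for every union `Λ` of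
cells of `u`, every cell `x`, every `[0,1]`-valued measurable observable `g` of the cell `x` and exteriors `ζ, ζ'` agreeing off `Λ` on the cells within
index distance `j(2n+1)` of `x`: `|∫ g dγ_Λ(ζ) − ∫ g dγ_Λ(ζ')| ≤ (ε·shellCount n)^j`.  (`univShellCond_bootstrap` is the case `Λ ⊆` window, `x = 0`.) -/
theorem univShellCond_cell_decay (hρ : Continuous ρ) {β : ℝ} {b n : ℕ} (hb : 1 ≤ b) {ε : ℝ} (hε : 0 ≤ ε)
    (hU : UnivShellCond ρ β b n ε) {u : Fin 4 → ℤ → ℤ} (hu : AfPincerUc.IsFrame b u) (j : ℕ)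
    (Λ : Finset (ZdEdge 4)) (hΛ : ∀ v v', frameCell u v = frameCell u v' → v ∈ Λ → v' ∈ Λ)
    (x : Cell) (g : LGConfig 4 G → ℝ) (hgm : Measurable g) (hg01 : ∀ σ, 0 ≤ g σ ∧ g σ ≤ 1)
    (hgdep : DependsOn g {v | frameCell u v = x}) (ζ ζ' : LGConfig 4 G)
    (hagree : ∀ v, v ∉ Λ → (∀ i, |frameCell u v i - x i| ≤ j * (2 * n + 1)) → ζ v = ζ' v) :
    |∫ σ, g σ ∂(ymSpecification ρ β Λ ζ) - ∫ σ, g σ ∂(ymSpecification ρ β Λ ζ')| ≤ (ε * shellCount n) ^ j := by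
  have hu1 := frame_step hu hb
  have hγ := QuantumFieldTheory.isSpecification_ymSpecification_of_t2Space (d := 4) ρ hρ β
  have h := recursion_decay (d := 4) hγ
    (fun Λ g T hg hT => dependsOn_integral_ymSpecification ρ hρ β Λ hg hT)
    (cell := frameCell u) (frame_hC1 hu1) (finite_frameCell hu1) hε
    (frameFS_of_univShellCond ρ hb hU hu) j Λ hΛ x g hgm hg01 hgdep ζ ζ' hagree
  rwa [recursionCount_eq_shellCount] at h

end Decay

/-! ## §2 The influence bound for the link ratio on a COARSE frame from the universal shell condition on the FINE frame -/

section Influence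

variable (G : Type) [Group G] [TopologicalSpace G] [IsTopologicalGroup G] [CompactSpace G] [MeasurableSpace G] [BorelSpace G]
  (r : Literature.MathematicalPhysics.QuantumFieldTheory.LatticeRep G)

/-- **The two-exterior influence bound for the link ratio from TV mixing at a finer mesh.**  `UnivShellCond r.ρ β b n ε` (`b ≥ 1`, `ε ≥ 0`), a frame `w`
of mesh `K·b` with `K ≥ j(2n+1) + 2`, ANY cell set `Y`, any link `a`, `x : G`, and exteriors `ω, η` agreeing on the links off the inner volume within
sup-distance `2·1·(K·b)` of `a` ⇒ the inner-kernel averages of `linkRatio r.ρ β w Y a x` differ by at most `48·e^{12N|β|}·(ε·shellCount n)^j`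
(refine the frame; DLR peeling over the `≤ 24` fine cells met by the plaquette neighbourhood of `a`; single-cell decay of §1 at radius `j(2n+1)`). -/
theorem linkRatio_influence_of_univShellCond {β ε : ℝ} {b n : ℕ} (hb : 1 ≤ b) (hε : 0 ≤ ε)
    (hU : UnivShellCond r.ρ β b n ε) (j : ℕ) {K : ℕ} (hK : j * (2 * n + 1) + 2 ≤ K) {w : Fin 4 → ℤ → ℤ}
    (hw : AfPincerUc.IsFrame (K * b) w) (Y : Finset Cell) (a : ZdEdge 4) (x : G) (ω η : LGConfig 4 G)
    (hagree : ∀ z : ZdEdge 4, z ∉ innerEdges w Y → ⌊‖z.1 - a.1‖⌋₊ ≤ 2 * 1 * (K * b) → ω z = η z) :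
    |(∫ V, linkRatio r.ρ β w Y a x V ∂(ymSpecification r.ρ β (innerEdges w Y) ω)) -
        ∫ V, linkRatio r.ρ β w Y a x V ∂(ymSpecification r.ρ β (innerEdges w Y) η)| ≤
      48 * Real.exp (12 * r.N * |β|) * (ε * shellCount n) ^ j := by
  classical
  haveI := r.t2Space
  haveI := r.secondCountableTopology
  have hρ := r.continuous
  have hK1 : 1 ≤ K := by omega
  have hu : AfPincerUc.IsFrame b (refineFrame K b w) := isFrame_refineFrame hK1 hw
  -- the observable: bounded by `e^{12N|β|}`, measurable, a cylinder on the plaquette neighbourhood of `a`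
  have hEb : ∀ V, |linkRatio r.ρ β w Y a x V| ≤ Real.exp (12 * r.N * |β|) := fun V => by
    have h := linkRatio_bounds G r (β := β) (w := w) (Y := Y) a x V
    rw [abs_of_pos ((Real.exp_pos _).trans_le h.1)]
    exact h.2
  have hEm : Measurable (linkRatio r.ρ β w Y a x) := by
    refine (Real.continuous_exp.comp (continuous_const.mul ?_)).measurable
    exact ((continuous_wilsonBoundaryAction r.ρ hρ (innerEdges w Y)).comp (continuous_id.update a continuous_const)).sub
      (continuous_wilsonBoundaryAction r.ρ hρ (innerEdges w Y))
  -- the fine cells met by the plaquette neighbourhood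
  set Yc : Finset Cell := ((plaquettesTouching ({a} : Finset (ZdEdge 4))).biUnion plaquetteEdges).image
    (frameCell (refineFrame K b w)) with hYc
  have hdep : DependsOn (linkRatio r.ρ β w Y a x) {v | frameCell (refineFrame K b w) v ∈ Yc} := by
    intro U V hUV
    refine dependsOn_linkRatio r.ρ β a x fun e he => hUV e ?_
    have he' : e ∈ (plaquettesTouching ({a} : Finset (ZdEdge 4))).biUnion plaquetteEdges := Finset.mem_coe.1 he
    show frameCell (refineFrame K b w) e ∈ Yc
    rw [hYc]
    exact Finset.mem_image_of_mem (frameCell (refineFrame K b w)) he'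
  have hγ := QuantumFieldTheory.isSpecification_ymSpecification_of_t2Space (d := 4) r.ρ hρ β
  have hθ : 0 ≤ (ε * shellCount n) ^ j := pow_nonneg (mul_nonneg hε (shellCount_nonneg' n)) j
  -- single-cell decay on the fine frame (§1), in the chain rule's hypothesis shape
  have hR : ∀ (Λ : Finset (ZdEdge 4)), (∀ v v', frameCell (refineFrame K b w) v = frameCell (refineFrame K b w) v' → v ∈ Λ → v' ∈ Λ) →
      ∀ (y : Cell) (g : LGConfig 4 G → ℝ), Measurable g → (∀ σ, 0 ≤ g σ ∧ g σ ≤ 1) →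
      DependsOn g {v | frameCell (refineFrame K b w) v = y} →
      ∀ ζ ζ' : LGConfig 4 G, (∀ v, v ∉ Λ → (∀ i, |frameCell (refineFrame K b w) v i - y i| ≤ j * (2 * n + 1)) → ζ v = ζ' v) →
        |∫ σ, g σ ∂(ymSpecification r.ρ β Λ ζ) - ∫ σ, g σ ∂(ymSpecification r.ρ β Λ ζ')| ≤ (ε * shellCount n) ^ j :=
    fun Λ hΛ y g hgm hg01 hgdep ζ ζ' hag => univShellCond_cell_decay r.ρ hρ hb hε hU hu j Λ hΛ y g hgm hg01 hgdep ζ ζ' hag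
  -- the agreement hypothesis of the chain rule: fine cells near the plaquette neighbourhood are within `2K·b` of `a`
  have hagree' : ∀ y ∈ Yc, ∀ v, v ∉ innerEdges w Y →
      (∀ i, |frameCell (refineFrame K b w) v i - y i| ≤ j * (2 * n + 1)) → ω v = η v := by
    intro y hy v hv hnear
    obtain ⟨e, he, rfl⟩ := Finset.mem_image.1 hy
    refine hagree v hv ?_
    have hN : ∀ i, |frameCell (refineFrame K b w) v i - frameCell (refineFrame K b w) e i| ≤ ((j * (2 * n + 1) : ℕ) : ℤ) :=
      fun i => by push_cast; exact hnear i
    have hKb : 2 * 1 * ((j * (2 * n + 1) + 2) * b) ≤ 2 * 1 * (K * b) := Nat.mul_le_mul_left (2 * 1) (Nat.mul_le_mul_right b hK)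
    exact (floor_norm_le_of_near_plaqNbhd hu hb he hN).trans hKb
  have hmain : |(∫ V, linkRatio r.ρ β w Y a x V ∂(ymSpecification r.ρ β (innerEdges w Y) ω)) -
      ∫ V, linkRatio r.ρ β w Y a x V ∂(ymSpecification r.ρ β (innerEdges w Y) η)| ≤
      2 * Real.exp (12 * r.N * |β|) * ((Yc.card : ℝ) * (ε * shellCount n) ^ j) :=
    multiCell_influence_general_of_abs_le (V := ZdEdge 4) (S := G) (C := Cell) (cell := frameCell (refineFrame K b w))
      (near := fun y v => ∀ i, |frameCell (refineFrame K b w) v i - y i| ≤ j * (2 * n + 1))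
      (fun v i => by rw [sub_self, abs_zero]; positivity) hγ hR
      Yc (innerEdges w Y) (innerEdges_union_refine hK1 hb hw Y) (linkRatio r.ρ β w Y a x) hEm hEb hdep ω η hagree'
  refine hmain.trans ?_
  have hcard : (Yc.card : ℝ) ≤ 24 := by exact_mod_cast Finset.card_image_le.trans (card_plaqNbhd_le a)
  have h1 : (Yc.card : ℝ) * (ε * shellCount n) ^ j ≤ 24 * (ε * shellCount n) ^ j := mul_le_mul_of_nonneg_right hcard hθ
  have h2 := mul_le_mul_of_nonneg_left h1 (by positivity : (0 : ℝ) ≤ 2 * Real.exp (12 * r.N * |β|))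
  linarith

end Influence

/-! ## §3 ★ TV ⇒ W: the class of record at mesh `K·b` from the universal shell condition at mesh `b` -/

section ClassW

variable (G : Type) [Group G] [TopologicalSpace G] [IsTopologicalGroup G] [CompactSpace G] [MeasurableSpace G] [BorelSpace G]
  (r : Literature.MathematicalPhysics.QuantumFieldTheory.LatticeRep G)

/-- **THE NUMBER of this file**: the activity radius reached at the coarse mesh `B` after `j` bootstrap steps with contraction `θ = ε·shellCount n`:
`mixingRadius N β θ B j = exp(3072 · B⁴ · e^{24N|β|} · θ^j) − 1` (`3072 = 64 · 48`; compare `meshRadiusKR`: `q^{2nb}` in place of `θ^j`). -/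
def mixingRadius (N : ℕ) (β θ : ℝ) (B j : ℕ) : ℝ :=
  Real.exp (3072 * (B : ℝ) ^ 4 * Real.exp (24 * N * |β|) * θ ^ j) - 1

omit [TopologicalSpace G] [IsTopologicalGroup G] [CompactSpace G] [MeasurableSpace G] [BorelSpace G] in
/-- The algebra `64 B⁴ (e^{12N|β|} · 48 e^{12N|β|} θ^j) = 3072 B⁴ e^{24N|β|} θ^j`. -/
theorem sixtyfour_mul_influence_eq (N : ℕ) (β θ : ℝ) (B j : ℕ) :
    64 * (B : ℝ) ^ 4 * (Real.exp (12 * N * |β|) * (48 * Real.exp (12 * N * |β|) * θ ^ j)) =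
      3072 * (B : ℝ) ^ 4 * Real.exp (24 * N * |β|) * θ ^ j := by
  have h2c : Real.exp (12 * N * |β|) * Real.exp (12 * N * |β|) = Real.exp (24 * N * |β|) := by
    rw [← Real.exp_add]; congr 1; ring
  calc 64 * (B : ℝ) ^ 4 * (Real.exp (12 * N * |β|) * (48 * Real.exp (12 * N * |β|) * θ ^ j))
      = 3072 * (B : ℝ) ^ 4 * (Real.exp (12 * N * |β|) * Real.exp (12 * N * |β|)) * θ ^ j := by ring
    _ = 3072 * (B : ℝ) ^ 4 * Real.exp (24 * N * |β|) * θ ^ j := by rw [h2c]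

/-- ★ **TV ⇒ W — the class of record from the universal shell condition, at EVERY `β`, every compact `G`, every lattice representation.**
`UnivShellCond r.ρ β b n ε` (`b ≥ 1`, `ε ≥ 0`) and `K ≥ j(2n+1) + 2` ⇒ `BlockedActivityClassW r.ρ β (K·b) 1 (mixingRadius r.N β (ε·shellCount n) (K·b) j)`:
the format's total-variation mixing at mesh `b` puts the mesh-`K·b` blocked kernels in the lane's activity class (centre-cell ratio mixing) with radius
`exp(3072 (Kb)⁴ e^{24N|β|} (ε·shellCount n)^j) − 1`.  (g5's `blockedActivityClassW_of_influence` fed by §2.) -/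
theorem blockedActivityClassW_of_univShellCond {β ε : ℝ} {b n : ℕ} (hb : 1 ≤ b) (hε : 0 ≤ ε) (hU : UnivShellCond r.ρ β b n ε)
    (j : ℕ) {K : ℕ} (hK : j * (2 * n + 1) + 2 ≤ K) :
    BlockedActivityClassW r.ρ β (K * b) 1 (mixingRadius r.N β (ε * shellCount n) (K * b) j) := by
  have hθ : 0 ≤ (ε * shellCount n) ^ j := pow_nonneg (mul_nonneg hε (shellCount_nonneg' n)) j
  have hKb : 1 ≤ K * b := Nat.one_le_iff_ne_zero.2 (Nat.mul_ne_zero (by omega) (by omega))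
  have h := blockedActivityClassW_of_influence G r (ι := 48 * Real.exp (12 * r.N * |β|) * (ε * shellCount n) ^ j) (by positivity) hKb le_rfl
    fun w hw Y _ _ a _ x ω η hag => linkRatio_influence_of_univShellCond G r hb hε hU j hK hw Y a x ω η hag
  unfold mixingRadius
  rw [← sixtyfour_mul_influence_eq]
  exact h

/-- … hence the W|Typ class for EVERY class `Typ`, at every centre, on every mesh-`K·b` frame. -/
theorem blockedActivityTypWAll_of_univShellCond {β ε : ℝ} {b n : ℕ} (hb : 1 ≤ b) (hε : 0 ≤ ε) (hU : UnivShellCond r.ρ β b n ε)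
    (j : ℕ) {K : ℕ} (hK : j * (2 * n + 1) + 2 ≤ K) {w : Fin 4 → ℤ → ℤ} (hw : AfPincerUc.IsFrame (K * b) w) (Typ : Cell → Set (LGConfig 4 G)) :
    BlockedActivityTypWAll r.ρ β w 1 (mixingRadius r.N β (ε * shellCount n) (K * b) j) Typ := fun c₀ =>
  blockedActivityTypW_of_blockedActivityClassW (blockedActivityClassW_of_univShellCond G r hb hε hU j hK) (shiftFrame_mesh hw c₀) _

/-- **RATIO clause (i) from TV clause (i) (σ-uniform)**: `UnivShellCond r.ρ β b n ε` ⇒ on every mesh-`K·b` frame `w` (`K ≥ j(2n+1)+2`), window `1`,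
for EVERY `Typ`: `RatioClauseI r.ρ β w 1 (3072 (Kb)⁴ e^{24N|β|} (ε·shellCount n)^j) Typ`. -/
theorem ratioClauseI_of_univShellCond {β ε : ℝ} {b n : ℕ} (hb : 1 ≤ b) (hε : 0 ≤ ε) (hU : UnivShellCond r.ρ β b n ε)
    (j : ℕ) {K : ℕ} (hK : j * (2 * n + 1) + 2 ≤ K) {w : Fin 4 → ℤ → ℤ} (hw : AfPincerUc.IsFrame (K * b) w) (Typ : Cell → Set (LGConfig 4 G)) :
    RatioClauseI r.ρ β w 1 (3072 * (((K * b : ℕ)) : ℝ) ^ 4 * Real.exp (24 * r.N * |β|) * (ε * shellCount n) ^ j) Typ := by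
  have hθ : 0 ≤ (ε * shellCount n) ^ j := pow_nonneg (mul_nonneg hε (shellCount_nonneg' n)) j
  have hKb : 1 ≤ K * b := Nat.one_le_iff_ne_zero.2 (Nat.mul_ne_zero (by omega) (by omega))
  have h := ratioClauseI_of_influence G r (ι := 48 * Real.exp (12 * r.N * |β|) * (ε * shellCount n) ^ j) (by positivity) hw hKb le_rfl
    (fun Y _ _ a _ x ω η hag => linkRatio_influence_of_univShellCond G r hb hε hU j hK hw Y a x ω η hag) Typ
  rw [sixtyfour_mul_influence_eq] at h
  exact h

end ClassW

/-! ## §4 Every radius at all large meshes: the W-onset mesh from the TV-onset mesh -/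

section Eventually

variable (G : Type) [Group G] [TopologicalSpace G] [IsTopologicalGroup G] [CompactSpace G] [MeasurableSpace G] [BorelSpace G]
  (r : Literature.MathematicalPhysics.QuantumFieldTheory.LatticeRep G)

omit [TopologicalSpace G] [IsTopologicalGroup G] [CompactSpace G] [MeasurableSpace G] [BorelSpace G] in
/-- The radius is monotone in the mesh. -/
theorem mixingRadius_mono_mesh (N : ℕ) (β : ℝ) {θ : ℝ} (hθ : 0 ≤ θ) {B B' : ℕ} (h : B ≤ B') (j : ℕ) :
    mixingRadius N β θ B j ≤ mixingRadius N β θ B' j := by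
  unfold mixingRadius
  have hB : (B : ℝ) ≤ (B' : ℝ) := by exact_mod_cast h
  have hθj : 0 ≤ θ ^ j := pow_nonneg hθ j
  gcongr

/-- **Geometric beats quartic**: `((j·p + q)·b)⁴ · θ^j → 0` for `0 ≤ θ < 1`. -/
theorem pow_four_mul_geom_tendsto_zero {θ : ℝ} (hθ0 : 0 ≤ θ) (hθ1 : θ < 1) (p q b : ℕ) :
    Tendsto (fun j : ℕ => ((((j * p + q) * b : ℕ)) : ℝ) ^ 4 * θ ^ j) atTop (𝓝 0) := by
  -- squeezed between `0` and `C · (j⁴ θ^j)` for `j ≥ 1`, `C = ((p+q)b)⁴`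
  set C : ℝ := (((p + q) * b : ℕ) : ℝ) ^ 4 with hC
  have hgeo : Tendsto (fun j : ℕ => C * ((j : ℝ) ^ 4 * θ ^ j)) atTop (𝓝 0) := by
    have h := tendsto_pow_const_mul_const_pow_of_abs_lt_one 4 (show |θ| < 1 by rwa [abs_of_nonneg hθ0])
    simpa using h.const_mul C
  refine tendsto_of_tendsto_of_tendsto_of_le_of_le' tendsto_const_nhds hgeo ?_ ?_
  · exact Eventually.of_forall fun j => by positivity
  · filter_upwards [eventually_ge_atTop 1] with j hj
    have hB : ((((j * p + q) * b : ℕ)) : ℝ) ≤ (((p + q) * b : ℕ) : ℝ) * (j : ℝ) := by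
      have hq : q ≤ q * j := Nat.le_mul_of_pos_right q hj
      have h1 : (j * p + q) * b ≤ (j * p + q * j) * b := Nat.mul_le_mul_right b (by omega)
      have h2 : (j * p + q * j) * b = ((p + q) * b) * j := by ring
      exact_mod_cast h1.trans_eq h2
    have hB0 : 0 ≤ ((((j * p + q) * b : ℕ)) : ℝ) := by positivity
    have hB4 : ((((j * p + q) * b : ℕ)) : ℝ) ^ 4 ≤ ((((p + q) * b : ℕ) : ℝ) * (j : ℝ)) ^ 4 := pow_le_pow_left₀ hB0 hB 4
    have hθj : 0 ≤ θ ^ j := pow_nonneg hθ0 j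
    calc ((((j * p + q) * b : ℕ)) : ℝ) ^ 4 * θ ^ j ≤ ((((p + q) * b : ℕ) : ℝ) * (j : ℝ)) ^ 4 * θ ^ j := by gcongr
      _ = C * ((j : ℝ) ^ 4 * θ ^ j) := by rw [hC]; ring

omit [TopologicalSpace G] [IsTopologicalGroup G] [CompactSpace G] [MeasurableSpace G] [BorelSpace G] in
/-- **The radius along linearly growing meshes tends to `0`**: `B_j = (j·p + q)·b`, `0 ≤ θ < 1` ⇒ `mixingRadius N β θ B_j j → 0`. -/
theorem mixingRadius_linear_tendsto_zero (N : ℕ) (β : ℝ) {θ : ℝ} (hθ0 : 0 ≤ θ) (hθ1 : θ < 1) (p q b : ℕ) :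
    Tendsto (fun j : ℕ => mixingRadius N β θ ((j * p + q) * b) j) atTop (𝓝 0) := by
  have hA : Tendsto (fun j : ℕ => 3072 * ((((j * p + q) * b : ℕ)) : ℝ) ^ 4 * Real.exp (24 * N * |β|) * θ ^ j) atTop (𝓝 0) := by
    have h := (pow_four_mul_geom_tendsto_zero hθ0 hθ1 p q b).const_mul (3072 * Real.exp (24 * N * |β|))
    rw [mul_zero] at h
    refine h.congr fun j => ?_
    ring
  have hexp0 : Tendsto (fun j : ℕ => Real.exp (3072 * ((((j * p + q) * b : ℕ)) : ℝ) ^ 4 * Real.exp (24 * N * |β|) * θ ^ j) - 1)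
      atTop (𝓝 (Real.exp 0 - 1)) := ((Real.continuous_exp.tendsto 0).comp hA).sub_const 1
  rw [Real.exp_zero, sub_self] at hexp0
  exact hexp0

/-- ★ **Every radius at all large meshes of the sequence `(j(2n+1)+2)·b`.**  `UnivShellCond r.ρ β b n ε` with `0 ≤ ε`, `ε·shellCount n < 1`, `b ≥ 1` ⇒ for
every `a > 0` there is `j₀` with `BlockedActivityClassW r.ρ β ((j(2n+1)+2)·b) 1 a` for all `j ≥ j₀`. -/
theorem blockedActivityClassW_eventually_of_univShellCond {β ε : ℝ} {b n : ℕ} (hb : 1 ≤ b) (hε : 0 ≤ ε) (hlt : ε * shellCount n < 1)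
    (hU : UnivShellCond r.ρ β b n ε) {a : ℝ} (ha : 0 < a) :
    ∃ j₀ : ℕ, ∀ j : ℕ, j₀ ≤ j → BlockedActivityClassW r.ρ β ((j * (2 * n + 1) + 2) * b) 1 a := by
  have hθ0 : 0 ≤ ε * shellCount n := mul_nonneg hε (shellCount_nonneg' n)
  have hT := mixingRadius_linear_tendsto_zero r.N β hθ0 hlt (2 * n + 1) 2 b
  obtain ⟨j₀, hj₀⟩ := eventually_atTop.1 (hT.eventually (gt_mem_nhds ha))
  exact ⟨j₀, fun j hj => blockedActivityClassW_mono G (blockedActivityClassW_of_univShellCond G r hb hε hU j le_rfl) (hj₀ j hj).le⟩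

/-- **Some W-mesh for every radius**: `UnivShellCond r.ρ β b n ε` (`0 ≤ ε`, `ε·shellCount n < 1`, `b ≥ 1`), `a > 0` ⇒ `∃ B ≥ b` (a multiple of `b`) with
`BlockedActivityClassW r.ρ β B 1 a`. -/
theorem exists_mesh_blockedActivityClassW_of_univShellCond {β ε : ℝ} {b n : ℕ} (hb : 1 ≤ b) (hε : 0 ≤ ε) (hlt : ε * shellCount n < 1)
    (hU : UnivShellCond r.ρ β b n ε) {a : ℝ} (ha : 0 < a) :
    ∃ B : ℕ, b ≤ B ∧ b ∣ B ∧ BlockedActivityClassW r.ρ β B 1 a := by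
  obtain ⟨j₀, hj₀⟩ := blockedActivityClassW_eventually_of_univShellCond G r hb hε hlt hU ha
  refine ⟨(j₀ * (2 * n + 1) + 2) * b, Nat.le_mul_of_pos_left b (by omega), Dvd.intro_left _ rfl, hj₀ j₀ le_rfl⟩

end Eventually

end Summit.QuantumFields.YangMills.Cruxes.IR.BlockedActivity

end
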